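import Literature.Probability.RandomPlanarGeometry.SLETraceMarkov
import Literature.Probability.RandomPlanarGeometry.LoewnerBoundaryExtension
import Literature.Probability.RandomPlanarGeometry.CritPercSLESimplePathProofs
import Literature.Probability.RandomPlanarGeometry.LocalMartingaleProofs
import Mathlib.Topology.MetricSpace.Sequences
import HarnessLib

/-!
# Transience of the SLE trace, `κ ≤ 4`: the step "`0 ∉ cl γ[1, ∞)`" from Lemma 7.2

Trunk T-STOCH. S. Rohde, O. Schramm, *Basic properties of SLE*, Ann. of Math. 161 (2005),
proof of Thm. 7.1, case `κ ∈ [0, 4]` (p. 911):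

> "In this range, `γ` is a simple path. Then a.s. there are two limit points `x₀, x₁` for
> `g₁(z)` as `z → 0` in `H₁`. Note that `g₁(γ[1, ∞))` has the same distribution as `γ[0, ∞)`
> translated by `ξ(1)`. Consequently, Lemma 7.2 shows that a.s. `x₀` and `x₁` are not in the
> closure of `g₁(γ[1, ∞))`. This means that `0 ∉ cl γ[1, ∞)` a.s."

This file **proves** that step, in the following form, which avoids the prime-end count at `0`
("two limit points") altogether:

* `Loewner.IsGeneratedByCurve.zero_notMem_closure_image_Ici_of_shift` (**deterministic**, every
  continuous driving function `W`): if the chain of `W` is generated by `γ` with `γ(s) ≠ 0`, the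
  chain of the increments `W(s + ·) - W(s)` is generated by `γˢ`, and no nonzero real point lies
  in the closure of `γˢ[0, ∞)`, then `0 ∉ cl γ[s, ∞)`. Indeed `γ(s + u) = Fₛ(γˢ(u) + W(s))`
  (`IsGeneratedByCurve.apply_add_eq_extendFrom`, the Markov identification of
  `SLETraceMarkov.lean`, `Fₛ = f̄ₛ` the continuous extension of `gₛ⁻¹` to the closed half-plane,
  `LoewnerBoundaryExtension.lean`); if `γ(s + uₙ) → 0` then the points `wₙ = γˢ(uₙ) + W(s)`
  stay bounded (`|gₛ z - z|` is bounded on `Hₛ`, `norm_map_sub_self_le_of_mem_domain`), a limit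
  point `w` has `Fₛ(w) = 0`, hence is real (`Fₛ(ℍₒ) = Hₛ ⊆ ℍₒ`) and `≠ W(s)`
  (`Fₛ(W s) = γ(s) ≠ 0`), so that `w - W(s)` is a nonzero real point of `cl γˢ[0, ∞)`.
* `ae_zero_notMem_closure_sleTrace_image_Ici_of_forall_notMem_closure` (**SLE_κ, `κ ≤ 4`**):
  if SLE_κ is a.s. generated by a curve (`HasSLETrace κ`), the chain of the increments of
  `√κ B` after time `1` is a.s. generated by a curve (hypothesis `hs`; supplied for `κ ≠ 0, 8`
  by Cor. 3.5, `ae_exists_isGeneratedByCurve_shift_of_cor35`), and Lemma 7.2 holds in the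
  simultaneous form "a.s., no nonzero real point is in `cl γ[0, ∞)`" (hypothesis `h72`), then
  a.s. `0 ∉ cl γ[1, ∞)`. The trace is a.s. simple for `κ ≤ 4` given `HasSLETrace κ`
  (`ae_isSimpleTrace_sleTrace_of_hasSLETrace`, Thm. 6.1, proved in the tree), so `γ(1) ∈ ℍₒ`;
  the hypothesis `h72` is transported to the shifted trace along the identity in law
  `identDistrib_trace_shift` through the measurable path-space event `Literature.Probability.RandomPlanarGeometry.realAvoidSet`
  (which, for continuous paths, says exactly that no nonzero real point is in the closure of
  the range, `mem_realAvoidSet_iff`).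
* `tendsto_norm_sleTrace_atTop_of_forall_notMem_closure` — hence, with the proved scaling and
  zero-one steps (`tendsto_norm_sleTrace_atTop_of_notMem_closure`, `SLETransience.lean`), the
  trace is a.s. transient under the same hypotheses: for `κ ≤ 4`, Theorem 7.1 is thereby
  reduced to the existence of the (shifted) trace and the simultaneous form of Lemma 7.2.

The simultaneous form of Lemma 7.2 is what its printed proof yields for `κ < 4` (the bound is
uniform in the point); it is kept as a hypothesis here, to be discharged separately.

## References

* S. Rohde, O. Schramm, *Basic properties of SLE*, Ann. of Math. 161 (2005), §7: Lemma 7.2,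
  Theorem 7.1 and its proof (pp. 909–911); Prop. 2.1 (ii).
* G. F. Lawler, *Conformally Invariant Processes in the Plane*, AMS (2005), §6.2 (the curves
  `γˢ`), Prop. 4.31 / Rem. 4.32 (boundary extension of `gₜ⁻¹`).
-/

noncomputable section

open Set Filter Topology MeasureTheory ProbabilityTheory Complex Metric
open UpperHalfPlane (upperHalfPlaneSet isOpen_upperHalfPlaneSet)
open scoped NNReal

namespace Literature.Probability.RandomPlanarGeometry

/-! ### The deterministic step -/

namespace Loewner

variable {W : ℝ≥0 → ℝ} {γ γs : ℝ≥0 → ℂ}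

/-- `|f̄ₛ w - w|` is bounded on the open half-plane: `f̄ₛ w = fₛ w ∈ Hₛ` and `gₛ (fₛ w) = w`,
so this is the uniform displacement bound `norm_map_sub_self_le_of_mem_domain` for `gₛ`.
[folklore] -/
theorem exists_norm_bdryInv_sub_self_le (hW : Continuous W) (s : ℝ≥0) :
    ∃ C : ℝ, ∀ w ∈ upperHalfPlaneSet, ‖bdryInv W s w - w‖ ≤ C := by
  -- a bound `M` for `|W u - W 0|` on `[0, s]`
  obtain ⟨M, hM⟩ : ∃ M : ℝ, ∀ u ∈ Icc (0 : ℝ) s, ‖(W u.toNNReal : ℂ) - (W 0 : ℂ)‖ ≤ M := by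
    have hc : ContinuousOn (fun u : ℝ ↦ ‖(W u.toNNReal : ℂ) - (W 0 : ℂ)‖) (Icc (0 : ℝ) s) :=
      ((Complex.continuous_ofReal.comp (hW.comp continuous_real_toNNReal)).sub
        continuous_const).norm.continuousOn
    obtain ⟨M, hM⟩ := (isCompact_Icc.image_of_continuousOn hc).isBounded.subset_closedBall 0
    refine ⟨M, fun u hu ↦ ?_⟩
    have := hM (mem_image_of_mem _ hu)
    simpa using this
  refine ⟨2 * M + 13 * Real.sqrt s, fun w hw ↦ ?_⟩
  have hz : bdryInv W s w ∈ domain W s := bdryInv_mem_domain hW s hw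
  have h := norm_map_sub_self_le_of_mem_domain hW hM hz
  rwa [map_bdryInv hW s hw, norm_sub_rev] at h

/-- **`0 ∉ cl γ[s, ∞)` from the avoidance of the nonzero reals by the shifted trace**
(Rohde–Schramm (2005), proof of Thm. 7.1, case `κ ≤ 4`, p. 911, without the prime-end count).
Let the chain of the continuous `W` be generated by `γ` with `γ(s) ≠ 0`, the chain of
`W(s + ·) - W(s)` by `γˢ`, and assume that no nonzero real point is in `cl γˢ[0, ∞)`. Then
`0 ∉ cl γ[s, ∞)`: if `γ(s + uₙ) = Fₛ(γˢ(uₙ) + W s) → 0`, perturb the bounded points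
`γˢ(uₙ) + W s` into `ℍₒ`, extract a limit `w` with `Fₛ w = 0`; `w` is real (`Fₛ(ℍₒ) ⊆ ℍₒ`),
`w ≠ W s` (`Fₛ(W s) = γ s ≠ 0`), and `w - W s ∈ cl γˢ[0, ∞)`.
[cite: RohdeSchramm2005, proof of Thm 7.1 (p. 911)] -/
theorem IsGeneratedByCurve.zero_notMem_closure_image_Ici_of_shift (hγ : IsGeneratedByCurve W γ)
    (hW : Continuous W) {s : ℝ≥0} (hs0 : γ s ≠ 0)
    (hγs : IsGeneratedByCurve (fun u ↦ W (s + u) - W s) γs)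
    (havoid : ∀ x : ℝ, x ≠ 0 → (x : ℂ) ∉ closure (range γs)) :
    (0 : ℂ) ∉ closure (γ '' Ici s) := by
  intro h0
  set F : ℂ → ℂ := bdryInv W s with hF
  have hFc : ContinuousOn F {z : ℂ | 0 ≤ z.im} := hγ.continuousOn_bdryInv hW s
  obtain ⟨C, hC⟩ := exists_norm_bdryInv_sub_self_le hW s
  -- a sequence `γ (s + u n) → 0`
  obtain ⟨z, hzmem, hzlim⟩ := mem_closure_iff_seq_limit.1 h0
  have hu : ∀ n, ∃ u : ℝ≥0, z n = F (γs u + W s) := by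
    intro n
    obtain ⟨t, ht, hzt⟩ := hzmem n
    refine ⟨t - s, ?_⟩
    have h := hγ.apply_add_eq_extendFrom hW hγs (t - s)
    rw [add_tsub_cancel_of_le (mem_Ici.1 ht)] at h
    rw [← hzt]
    exact h
  choose u hu using hu
  set w : ℕ → ℂ := fun n ↦ γs (u n) + W s with hw
  have hwim : ∀ n, 0 ≤ (w n).im := fun n ↦ by
    simp only [hw, Complex.add_im, Complex.ofReal_im, add_zero]
    exact hγs.im_nonneg (u n)
  -- perturb into the open half-plane keeping `F` within `1/(n+1)`
  have hpert : ∀ n : ℕ, ∃ ε : ℝ, 0 < ε ∧ ε ≤ 1 / ((n : ℝ) + 1) ∧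
      ‖F (w n + I * ε) - F (w n)‖ < 1 / ((n : ℝ) + 1) := by
    intro n
    have hn : (0 : ℝ) < 1 / ((n : ℝ) + 1) := by positivity
    have hcw : ContinuousWithinAt F {z : ℂ | 0 ≤ z.im} (w n) := hFc _ (hwim n)
    have ht : Tendsto (fun ε : ℝ ↦ w n + I * ε) (𝓝[>] 0) (𝓝[{z : ℂ | 0 ≤ z.im}] (w n)) := by
      refine tendsto_nhdsWithin_of_tendsto_nhds_of_eventually_within _ ?_ ?_
      · have : Tendsto (fun ε : ℝ ↦ w n + I * ε) (𝓝 0) (𝓝 (w n + I * (0 : ℝ))) :=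
          ((continuous_const.add (continuous_const.mul Complex.continuous_ofReal)).tendsto 0)
        rw [Complex.ofReal_zero, mul_zero, add_zero] at this
        exact this.mono_left nhdsWithin_le_nhds
      · filter_upwards [self_mem_nhdsWithin] with ε (hε : 0 < ε)
        simp only [Complex.add_im, Complex.mul_im, Complex.I_re, Complex.I_im,
          Complex.ofReal_re, Complex.ofReal_im, zero_mul, one_mul, zero_add]
        linarith [hwim n]
    have hlim : Tendsto (fun ε : ℝ ↦ F (w n + I * ε)) (𝓝[>] 0) (𝓝 (F (w n))) := hcw.tendsto.comp ht
    have hev : ∀ᶠ ε : ℝ in 𝓝[>] 0, ‖F (w n + I * ε) - F (w n)‖ < 1 / ((n : ℝ) + 1) := by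
      have := (tendsto_iff_norm_sub_tendsto_zero.1 hlim).eventually (gt_mem_nhds hn)
      exact this
    have hev2 : ∀ᶠ ε : ℝ in 𝓝[>] 0, ε ≤ 1 / ((n : ℝ) + 1) :=
      mem_nhdsWithin_of_mem_nhds (Iic_mem_nhds hn)
    obtain ⟨ε, ⟨h1, h2⟩, h3⟩ := ((hev.and hev2).and self_mem_nhdsWithin).exists
    exact ⟨ε, h3, h2, h1⟩
  choose ε hεpos hεle hεF using hpert
  set w' : ℕ → ℂ := fun n ↦ w n + I * (ε n) with hw'
  have hw'H : ∀ n, w' n ∈ upperHalfPlaneSet := fun n ↦ by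
    show 0 < (w n + I * (ε n)).im
    simp only [Complex.add_im, Complex.mul_im, Complex.I_re, Complex.I_im, Complex.ofReal_re,
      Complex.ofReal_im, zero_mul, one_mul]
    linarith [hwim n, hεpos n]
  -- `F (w' n) → 0`
  have hinv : Tendsto (fun n : ℕ ↦ (1 : ℝ) / (n + 1)) atTop (𝓝 0) := tendsto_one_div_add_atTop_nhds_zero_nat
  have hFw' : Tendsto (fun n ↦ F (w' n)) atTop (𝓝 0) := by
    have h1 : Tendsto (fun n ↦ F (w n)) atTop (𝓝 0) := by
      refine hzlim.congr fun n ↦ ?_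
      rw [hu n]
    have h2 : Tendsto (fun n ↦ F (w' n) - F (w n)) atTop (𝓝 0) := by
      refine squeeze_zero_norm (fun n ↦ (hεF n).le) hinv
    have := h2.add h1
    simpa using this
  -- the perturbed points are eventually bounded
  have hbdd : ∀ᶠ n in atTop, w' n ∈ closedBall (0 : ℂ) (C + 1) := by
    have hev : ∀ᶠ n in atTop, ‖F (w' n)‖ < 1 := by
      have := (tendsto_iff_norm_sub_tendsto_zero.1 hFw').eventually (gt_mem_nhds one_pos)
      simpa using this
    filter_upwards [hev] with n hn
    rw [mem_closedBall, dist_zero_right]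
    have h1 : ‖F (w' n) - w' n‖ ≤ C := hC _ (hw'H n)
    calc ‖w' n‖ = ‖F (w' n) - (F (w' n) - w' n)‖ := by rw [sub_sub_cancel]
      _ ≤ ‖F (w' n)‖ + ‖F (w' n) - w' n‖ := norm_sub_le _ _
      _ ≤ C + 1 := by linarith
  -- extract a convergent subsequence `w' (φ n) → wlim`
  obtain ⟨wlim, -, φ, hφ, hconv⟩ := tendsto_subseq_of_frequently_bounded isBounded_closedBall
    hbdd.frequently
  have hwlim_im : 0 ≤ wlim.im :=
    (isClosed_le continuous_const Complex.continuous_im).mem_of_tendsto hconv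
      (Eventually.of_forall fun n ↦ show 0 ≤ (w' (φ n)).im from (hw'H (φ n)).le)
  -- `F wlim = 0`
  have hFlim : F wlim = 0 := by
    have h1 : Tendsto (fun n ↦ F (w' (φ n))) atTop (𝓝 (F wlim)) := by
      refine (hFc wlim hwlim_im).tendsto.comp ?_
      exact tendsto_nhdsWithin_iff.2
        ⟨hconv, Eventually.of_forall fun n ↦ show 0 ≤ (w' (φ n)).im from (hw'H (φ n)).le⟩
    have h2 : Tendsto (fun n ↦ F (w' (φ n))) atTop (𝓝 0) := hFw'.comp hφ.tendsto_atTop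
    exact tendsto_nhds_unique h1 h2
  -- `wlim` is real
  have hreal : wlim.im = 0 := by
    refine le_antisymm (not_lt.1 fun hpos ↦ ?_) hwlim_im
    have hmem : F wlim ∈ domain W s := bdryInv_mem_domain hW s hpos
    have : (0 : ℝ) < (F wlim).im := hmem.1
    rw [hFlim, Complex.zero_im] at this
    exact lt_irrefl _ this
  have hwlim_eq : wlim = ((wlim.re : ℝ) : ℂ) := Complex.ext (by simp) (by simp [hreal])
  -- and differs from `W s`
  have hne : wlim.re ≠ W s := by
    intro heq
    have h1 : F (W s) = γ s := hγ.bdryInv_driving hW s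
    rw [← heq, ← hwlim_eq, hFlim] at h1
    exact hs0 h1.symm
  -- `wlim - W s` is a nonzero real point of `cl γˢ[0, ∞)`
  have hε0 : Tendsto (fun n ↦ ε (φ n)) atTop (𝓝 0) := by
    have h1 : Tendsto (fun n ↦ ε n) atTop (𝓝 0) :=
      squeeze_zero (fun n ↦ (hεpos n).le) hεle tendsto_one_div_add_atTop_nhds_zero_nat
    exact h1.comp hφ.tendsto_atTop
  have hwconv : Tendsto (fun n ↦ w (φ n)) atTop (𝓝 wlim) := by
    have h1 : ∀ n, w (φ n) = w' (φ n) - I * (ε (φ n)) := fun n ↦ by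
      simp only [hw']; ring
    simp_rw [h1]
    have h2 : Tendsto (fun n ↦ I * ((ε (φ n) : ℝ) : ℂ)) atTop (𝓝 (I * ((0 : ℝ) : ℂ))) :=
      (Complex.continuous_ofReal.tendsto 0 |>.comp hε0).const_mul I
    rw [Complex.ofReal_zero, mul_zero] at h2
    simpa using hconv.sub h2
  have hγsconv : Tendsto (fun n ↦ γs (u (φ n))) atTop (𝓝 (((wlim.re - W s : ℝ) : ℂ))) := by
    have h1 : ∀ n, γs (u (φ n)) = w (φ n) - (W s : ℂ) := fun n ↦ by simp only [hw]; ring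
    simp_rw [h1]
    have h2 := hwconv.sub_const (W s : ℂ)
    rw [hwlim_eq] at h2
    convert h2 using 2
    push_cast
    ring
  have hmem : (((wlim.re - W s : ℝ)) : ℂ) ∈ closure (range γs) :=
    mem_closure_of_tendsto hγsconv (Eventually.of_forall fun n ↦ mem_range_self _)
  exact havoid (wlim.re - W s) (sub_ne_zero.2 hne) hmem

end Loewner

/-! ### A measurable path-space event: no nonzero real point in the closure of the range -/

section PathEvent

/-- The compact pieces `Aₙ = {x ∈ ℝ : 1/(n+1) ≤ |x| ≤ n+1}` of `ℝ ∖ {0}`, seen in `ℂ`.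
[folklore] -/
def realAnnulus (n : ℕ) : Set ℂ :=
  {z : ℂ | z.im = 0 ∧ 1 / ((n : ℝ) + 1) ≤ |z.re| ∧ |z.re| ≤ (n : ℝ) + 1}

/-- `Aₙ` is compact. [folklore] -/
theorem isCompact_realAnnulus (n : ℕ) : IsCompact (realAnnulus n) := by
  refine Metric.isCompact_of_isClosed_isBounded ?_ ?_
  · refine (isClosed_eq Complex.continuous_im continuous_const).inter
      ((isClosed_le continuous_const (continuous_abs.comp Complex.continuous_re)).inter
        (isClosed_le (continuous_abs.comp Complex.continuous_re) continuous_const))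
  · refine (isBounded_closedBall (x := (0 : ℂ)) (r := (n : ℝ) + 1)).subset fun z hz ↦ ?_
    obtain ⟨him, -, hle⟩ := hz
    have hz' : z = ((z.re : ℝ) : ℂ) := Complex.ext (by simp) (by simp [him])
    rw [mem_closedBall, dist_zero_right, hz', Complex.norm_real, Real.norm_eq_abs]
    exact hle

/-- `1 ∈ Aₙ`; in particular `Aₙ` is nonempty. [folklore] -/
theorem one_mem_realAnnulus (n : ℕ) : (1 : ℂ) ∈ realAnnulus n := by
  refine ⟨by simp, ?_, ?_⟩
  · rw [Complex.one_re, abs_one, div_le_one (by positivity)]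
    linarith [n.cast_nonneg (α := ℝ)]
  · rw [Complex.one_re, abs_one]
    linarith [n.cast_nonneg (α := ℝ)]

/-- A nonzero real point lies in some `Aₙ`. [folklore] -/
theorem exists_ofReal_mem_realAnnulus {x : ℝ} (hx : x ≠ 0) : ∃ n : ℕ, (x : ℂ) ∈ realAnnulus n := by
  have hx' : 0 < |x| := abs_pos.2 hx
  refine ⟨max ⌈|x|⌉₊ ⌈1 / |x|⌉₊, by simp, ?_, ?_⟩
  · rw [Complex.ofReal_re, div_le_iff₀ (by positivity)]
    have h1 : 1 / |x| ≤ ⌈1 / |x|⌉₊ := Nat.le_ceil _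
    have h2 : (⌈1 / |x|⌉₊ : ℝ) ≤ ((max ⌈|x|⌉₊ ⌈1 / |x|⌉₊ : ℕ) : ℝ) := by exact_mod_cast le_max_right _ _
    have h3 : 1 / |x| * |x| = 1 := by field_simp
    nlinarith
  · rw [Complex.ofReal_re]
    have h1 : |x| ≤ ⌈|x|⌉₊ := Nat.le_ceil _
    have h2 : (⌈|x|⌉₊ : ℝ) ≤ ((max ⌈|x|⌉₊ ⌈1 / |x|⌉₊ : ℕ) : ℝ) := by exact_mod_cast le_max_left _ _
    linarith

/-- Points of `Aₙ` are nonzero reals. [folklore] -/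
theorem eq_ofReal_of_mem_realAnnulus {n : ℕ} {z : ℂ} (hz : z ∈ realAnnulus n) :
    z = ((z.re : ℝ) : ℂ) ∧ z.re ≠ 0 := by
  obtain ⟨him, hge, -⟩ := hz
  refine ⟨Complex.ext (by simp) (by simp [him]), fun h0 ↦ ?_⟩
  rw [h0, abs_zero] at hge
  have : (0 : ℝ) < 1 / ((n : ℝ) + 1) := by positivity
  linarith

/-- The path-space event "**no nonzero real point is in the closure of the range**", in a form
measurable for the product σ-algebra on `ℝ≥0 → ℂ`: for every `n`, the values of the path at the
rational times stay at distance `≥ 1/(k+1)` from `Aₙ` for some `k`. For continuous paths this is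
the named event (`mem_realAvoidSet_iff`). [folklore] -/
def realAvoidSet : Set (ℝ≥0 → ℂ) :=
  ⋂ n : ℕ, ⋃ k : ℕ, ⋂ q : ℚ, {p | 1 / ((k : ℝ) + 1) ≤ infDist (p (q : ℝ).toNNReal) (realAnnulus n)}

/-- `realAvoidSet` is measurable. [folklore] -/
theorem measurableSet_realAvoidSet : MeasurableSet realAvoidSet := by
  refine MeasurableSet.iInter fun n ↦ MeasurableSet.iUnion fun k ↦ MeasurableSet.iInter fun q ↦ ?_
  exact measurableSet_le measurable_const
    ((continuous_infDist_pt (realAnnulus n)).measurable.comp (measurable_pi_apply _))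

/-- For a **continuous** path `p`, `p ∈ realAvoidSet` iff no nonzero real point lies in the
closure of `range p`. (`⇒`: the distance bound extends from rational to all times by continuity
and density; `⇐`: the continuous function `z ↦ infDist z (range p)` is positive on the compact
`Aₙ`, hence bounded below there.) [folklore] -/
theorem mem_realAvoidSet_iff {p : ℝ≥0 → ℂ} (hp : Continuous p) :
    p ∈ realAvoidSet ↔ ∀ x : ℝ, x ≠ 0 → (x : ℂ) ∉ closure (range p) := by
  simp only [realAvoidSet, mem_iInter, mem_iUnion, mem_setOf_eq]
  constructor
  · intro h x hx hxcl
    obtain ⟨n, hn⟩ := exists_ofReal_mem_realAnnulus hx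
    obtain ⟨k, hk⟩ := h n
    have hkpos : (0 : ℝ) < 1 / ((k : ℝ) + 1) := by positivity
    -- the bound holds at every time
    have hall : ∀ t : ℝ≥0, 1 / ((k : ℝ) + 1) ≤ infDist (p t) (realAnnulus n) := by
      intro t
      by_contra hlt
      rw [not_le] at hlt
      have ho : IsOpen {u : ℝ≥0 | infDist (p u) (realAnnulus n) < 1 / ((k : ℝ) + 1)} :=
        isOpen_lt ((continuous_infDist_pt _).comp hp) continuous_const
      obtain ⟨δ, hδ, hball⟩ := Metric.isOpen_iff.1 ho t hlt
      obtain ⟨q, htq, hqt⟩ := exists_rat_btwn (show (t : ℝ) < t + δ by linarith)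
      have hq0 : (0 : ℝ) ≤ q := t.2.trans htq.le
      have hmem : (q : ℝ).toNNReal ∈ {u : ℝ≥0 | infDist (p u) (realAnnulus n) < 1 / ((k : ℝ) + 1)} := by
        refine hball ?_
        rw [Metric.mem_ball, NNReal.dist_eq, Real.coe_toNNReal _ hq0, abs_sub_lt_iff]
        constructor <;> linarith
      exact absurd (hk q) (not_le.2 hmem)
    obtain ⟨_, ⟨t, rfl⟩, hdist⟩ := Metric.mem_closure_iff.1 hxcl _ hkpos
    have h1 : infDist (p t) (realAnnulus n) ≤ dist (p t) x := infDist_le_dist_of_mem hn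
    rw [dist_comm] at hdist
    linarith [hall t]
  · intro h n
    have hne : (range p).Nonempty := range_nonempty p
    obtain ⟨z₀, hz₀, hmin⟩ := (isCompact_realAnnulus n).exists_isMinOn ⟨1, one_mem_realAnnulus n⟩
      (continuous_infDist_pt (range p)).continuousOn
    obtain ⟨hz₀eq, hz₀ne⟩ := eq_ofReal_of_mem_realAnnulus hz₀
    have hpos : 0 < infDist z₀ (range p) := by
      rw [hz₀eq]
      exact (Metric.infDist_pos_iff_notMem_closure hne).1 (h _ hz₀ne)
    obtain ⟨k, hk⟩ := exists_nat_one_div_lt hpos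
    refine ⟨k, fun q ↦ ?_⟩
    refine (Metric.le_infDist ⟨1, one_mem_realAnnulus n⟩).2 fun y hy ↦ ?_
    have h1 : infDist z₀ (range p) ≤ infDist y (range p) := hmin hy
    have h2 : infDist y (range p) ≤ dist y (p (q : ℝ).toNNReal) := infDist_le_dist_of_mem (mem_range_self _)
    rw [dist_comm] at h2
    linarith

end PathEvent

/-! ### The SLE statements -/

section SLE

variable {κ : ℝ≥0}

/-- **`0 ∉ cl γ[1, ∞)` a.s. for SLE_κ, `κ ≤ 4`, from the simultaneous form of Lemma 7.2**
(Rohde–Schramm (2005), proof of Thm. 7.1, case `κ ∈ [0, 4]`, p. 911). Hypotheses: SLE_κ is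
a.s. generated by a curve (`h0`), the chain of the increments of `√κ B` after time `1` is a.s.
generated by a curve (`hs`; from Cor. 3.5 for `κ ≠ 0, 8`, `ae_exists_isGeneratedByCurve_shift_of_cor35`),
and a.s. no nonzero real point lies in `cl γ[0, ∞)` (`h72`, the simultaneous form of Lemma 7.2).
The trace is a.s. simple (`ae_isSimpleTrace_sleTrace_of_hasSLETrace`, Thm. 6.1), so `γ(1) ≠ 0`;
`h72` is transported to the shifted trace by the identity in law `identDistrib_trace_shift`
through `realAvoidSet`; the deterministic step is
`Loewner.IsGeneratedByCurve.zero_notMem_closure_image_Ici_of_shift`.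
[cite: RohdeSchramm2005, proof of Thm 7.1 (p. 911)] -/
theorem ae_zero_notMem_closure_sleTrace_image_Ici_of_forall_notMem_closure (h0 : HasSLETrace κ)
    (hκ : κ ≤ 4)
    (hs : ∀ᵐ ω ∂Process.preWienerMeasure,
      ∃ γ, Loewner.IsGeneratedByCurve (fun u ↦ sleDriving κ ω (1 + u) - sleDriving κ ω 1) γ)
    (h72 : ∀ᵐ ω ∂Process.preWienerMeasure,
      ∀ x : ℝ, x ≠ 0 → (x : ℂ) ∉ closure (range (sleTrace κ ω))) :
    ∀ᵐ ω ∂Process.preWienerMeasure, (0 : ℂ) ∉ closure (sleTrace κ ω '' Ici 1) := by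
  set V : (ℝ≥0 → ℝ) → ℝ≥0 → ℝ := fun ω u ↦ sleDriving κ ω (1 + u) - sleDriving κ ω 1 with hV
  -- transport `h72` to the shifted trace along the identity in law
  have hlaw := identDistrib_trace_shift h0 hs
  have h1 : ∀ᵐ ω ∂Process.preWienerMeasure, sleTrace κ ω ∈ realAvoidSet := by
    filter_upwards [h0, h72] with ω hω h
    exact (mem_realAvoidSet_iff (Loewner.isGeneratedByCurve_trace hω).continuous).2 h
  have h2 : Process.preWienerMeasure ((fun ω ↦ Loewner.trace (V ω)) ⁻¹' realAvoidSetᶜ) = 0 := by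
    rw [hlaw.measure_mem_eq measurableSet_realAvoidSet.compl]
    refine measure_eq_zero_iff_ae_notMem.2 ?_
    filter_upwards [h1] with ω hω
    simpa using hω
  have h3 : ∀ᵐ ω ∂Process.preWienerMeasure, Loewner.trace (V ω) ∈ realAvoidSet := by
    filter_upwards [measure_eq_zero_iff_ae_notMem.1 h2] with ω hω
    simpa only [mem_preimage, mem_compl_iff, not_not] using hω
  filter_upwards [h0, hs, ae_isSimpleTrace_sleTrace_of_hasSLETrace h0 hκ, h3] with ω hω hωs hsim hav
  have hγs : Loewner.IsGeneratedByCurve (V ω) (Loewner.trace (V ω)) := Loewner.isGeneratedByCurve_trace hωs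
  have havoid := (mem_realAvoidSet_iff hγs.continuous).1 hav
  have hs0 : sleTrace κ ω 1 ≠ 0 := fun h ↦ by
    have := hsim.2 1 one_pos
    rw [h, Complex.zero_im] at this
    exact lt_irrefl _ this
  exact (Loewner.isGeneratedByCurve_trace hω).zero_notMem_closure_image_Ici_of_shift
    (continuous_sleDriving κ ω) hs0 hγs havoid

/-- **Transience of the SLE_κ trace, `κ ≤ 4`, from the simultaneous form of Lemma 7.2** and the
existence of the (shifted) trace: under the hypotheses of
`ae_zero_notMem_closure_sleTrace_image_Ici_of_forall_notMem_closure`, almost surely `|γ(t)| → ∞`.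
The remaining steps — scale invariance of the trace (`identDistrib_sleTrace_scale_of_hasSLETrace`)
and "`0 ∉ cl γ[1, ∞)` a.s. implies transience" (`tendsto_norm_sleTrace_atTop_of_notMem_closure`) —
are proved in the tree. Rohde–Schramm (2005), Thm. 7.1, case `κ ∈ [0, 4]`.
[cite: RohdeSchramm2005, Thm 7.1] -/
theorem tendsto_norm_sleTrace_atTop_of_forall_notMem_closure (h0 : HasSLETrace κ) (hκ : κ ≤ 4)
    (hs : ∀ᵐ ω ∂Process.preWienerMeasure,
      ∃ γ, Loewner.IsGeneratedByCurve (fun u ↦ sleDriving κ ω (1 + u) - sleDriving κ ω 1) γ)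
    (h72 : ∀ᵐ ω ∂Process.preWienerMeasure,
      ∀ x : ℝ, x ≠ 0 → (x : ℂ) ∉ closure (range (sleTrace κ ω))) :
    ∀ᵐ ω ∂Process.preWienerMeasure, Tendsto (fun t ↦ ‖sleTrace κ ω t‖) atTop atTop :=
  tendsto_norm_sleTrace_atTop_of_notMem_closure h0
    (fun hc ↦ identDistrib_sleTrace_scale_of_hasSLETrace h0 hc)
    (ae_zero_notMem_closure_sleTrace_image_Ici_of_forall_notMem_closure h0 hκ hs h72)

/-- **The same for `0 < κ ≤ 4` from Cor. 3.5**, which supplies both the trace and the shifted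
trace (`hasSLETrace_of_ne_eight_of_cor35`, `ae_exists_isGeneratedByCurve_shift_of_cor35`): for
such `κ`, Theorem 7.1 is reduced to Rohde–Schramm's Cor. 3.5 and the simultaneous form of
Lemma 7.2. [cite: RohdeSchramm2005, Thm 7.1] -/
theorem tendsto_norm_sleTrace_atTop_of_cor35_of_forall_notMem_closure
    (h : RohdeSchramm2005_cor35 Process.preWienerMeasure) (hκ0 : κ ≠ 0) (hκ : κ ≤ 4)
    (h72 : ∀ᵐ ω ∂Process.preWienerMeasure,
      ∀ x : ℝ, x ≠ 0 → (x : ℂ) ∉ closure (range (sleTrace κ ω))) :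
    ∀ᵐ ω ∂Process.preWienerMeasure, Tendsto (fun t ↦ ‖sleTrace κ ω t‖) atTop atTop := by
  have h8 : κ ≠ 8 := by
    intro h8; rw [h8] at hκ; norm_num at hκ
  exact tendsto_norm_sleTrace_atTop_of_forall_notMem_closure (hasSLETrace_of_ne_eight_of_cor35 h h8)
    hκ (ae_exists_isGeneratedByCurve_shift_of_cor35 h hκ0 h8 1) h72

end SLE

end Literature.Probability.RandomPlanarGeometry
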